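import Summits.QuantumFields.YangMills.Theorems.F4SubCurvatureDoorRationalToGeneralPringsheimOfLukacs
import Summits.QuantumFields.YangMills.Theorems.F4SubCurvatureDoorForwardConeLukacsOneDim
import Mathlib
import HarnessLib

/-!
# S1 programme (⟨stmt-QuantumFields-23125⟩) — rung `PringsheimIdentification` BY NAME

Crux `F4SubCurvatureDoor.RationalToGeneral` ⟨stmt-QuantumFields-23125⟩, owner file `Cruxes/RationalToGeneral/Lines/forward_cone_rungs.lean`
(ns `…ForwardConeRungs`).  Two lines: the glue `pringsheimIdentification_of_lukacsOneDim` (this seat, file `…PringsheimOfLukacs`, whose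
namespace carries the CHARACTER-IDENTICAL restatements of `LukacsOneDim` and `PringsheimIdentification`) fed with the tree theorem
`F4SubCurvatureDoorForwardConeLukacs.exists_expMoment_of_analyticAt_cosTransform` (width seat w3 g37, p718973), which IS `LukacsOneDim` unfolded.

HONEST LABEL: a rung of the OPEN stub S1 of the OPEN lines g21-A/B; nothing of S1, ⟨23125⟩, ⟨23035⟩, R2d is proved and the Yang–Mills mass gap
is NOT proved; no summit is proved by a line.  Lead seat `ym-line-sfw-p2` g75 (cell ym-idea-1, free hands).
-/

set_option autoImplicit false

noncomputable section

namespace Summit.QuantumFields.YangMills.Theorems.F4SubCurvatureDoorPringsheimIdentificationRegistered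

open Summit.QuantumFields.YangMills.Theorems.F4SubCurvatureDoorPringsheimOfLukacsRegistered
  (LukacsOneDim PringsheimIdentification pringsheimIdentification_of_lukacsOneDim)
open Summit.QuantumFields.YangMills.Theorems.F4SubCurvatureDoorForwardConeLukacs (exists_expMoment_of_analyticAt_cosTransform)

/-- **RUNG (by name): `PringsheimIdentification`** — unconditional: Lukacs' lemma is the tree theorem of p718973. -/
theorem pringsheimIdentification_holds : PringsheimIdentification :=
  pringsheimIdentification_of_lukacsOneDim fun m hm φ hφ hA => by
    haveI := hm
    exact exists_expMoment_of_analyticAt_cosTransform m φ hφ hA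

end Summit.QuantumFields.YangMills.Theorems.F4SubCurvatureDoorPringsheimIdentificationRegistered

end
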